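import Summits.ABC.ABC.Theorems.RibetTakahashiSplitManyPrimeValuationProductCoveringGlue
import Literature.NumberTheory.Automorphic.ShimuraCurve

/-!
# The minimal lever of crux line `jl-zero-cycle-height`, calibrated in tree vocabulary:
# `MeanSquareLowerBound` suffices for, and (modulo the two-sided package) is necessary for,
# `RibetTakahashiSplit.ManyPrimeValuationProduct` (stmt-ABC-1561)

Route `RibetTakahashiSplit`, crux r2 `ManyPrimeValuationProduct` (stmt-ABC-1561), line
`jl-zero-cycle-height` (`Cruxes/ManyPrimeValuationProduct/Lines/jl_zero_cycle_height.lean`, rev c2).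
The line's registered hard stub is the MINIMAL LEVER `MeanSquareLowerBound` — "Jacquet–Langlands
preserves the size of integral newforms": for every `ε > 0` there is `C` such that for every elliptic
`W/ℚ` semistable away from `2`, every covering set `D` of multiplicative primes (`#D` even, `≥ 2`, two
multiplicative primes outside `D`), every Néron period pair `L` of `W`, every Shimura-curve datum `X` of
level `(∏D, N/∏D)`, every fundamental domain `F` of finite positive volume and every non-zero weight-two
form `s` on `X.Gamma` with periods in `Λ_L` (plus the analytic side conditions the package supplies),
`log((vol F)⁻¹ ∫_F |s|² y² dμ) ≥ −(ε log N + C)`. It is the typed form `EigenformLowerBound 0` of the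
informal route item stmt-ABC-1755, over the landed vocabulary `Literature.NumberTheory.Automorphic.ShimuraCurve`.

This file lands, with every abbreviation of the skeleton unfolded (registered stubs, signatures
verbatim; both kernel-checked definitionally equal to the skeleton's
`FermatInputOnClass → JLPackage → MeanSquareLowerBound → ManyPrimeValuationProduct` and
`JLLowerPackage → PairedFactorisationBound → MeanSquareLowerBound`):

* `manyPrimeValuationProduct_of_lever` — **the lever suffices**: the Fermat input on the class
  (Pasten arXiv:1705.09251 L.6.11/L.6.12: for prime `ℓ ≥ 11` some multiplicative exponent is
  `≢ 0 mod ℓ`), the Jacquet–Langlands/Ribet–Takahashi/Pasten PACKAGE (Thm 6.1(b) + §16: for every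
  covering set a Néron-period form `s` on the Shimura curve of level `(∏D, N/∏D)` with
  `log T_D ≤ C + ε log N + log vol F − log ∫_F |s|²y²`) and the lever give the crux: per covering set
  `log T_D ≤ C₁ + C₂ + ε log N` (no Jensen needed), then the covering glue
  (`manyPrimeValuationProduct_of_pairedFactorisationBound`, three covering sets).
* `meanSquareLowerBound_of_lowerPackage_of_paired` — **the lever is necessary modulo the LOWER half
  of the package** (`log vol F − log ∫_F|s|² − ε log N − C ≤ log T_D` for every admissible `s`:
  Ribet–Takahashi numerator bound + Frey–Zagier on both curves + GHL): the paired crux `T_D ≤ C N^ε`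
  gives back the lever. So, modulo the two-sided package, lever ⟺ crux per covering set
  (Pasten's Conj. 1.14 in geometric form): the statement a planner promotes when promoting stub 4.

No definitions; theorems only. References: H. Pasten, *Shimura curves and the abc conjecture*,
J. Number Theory 254 (2024) 214–335 = arXiv:1705.09251, Thm 6.1(b), §16; K. Ribet, S. Takahashi,
PNAS 94 (1997); J. Hoffstein, P. Lockhart, Ann. of Math. 140 (1994).
-/

-- `Summit.ABC.ABC` is the mandated summit-side namespace (CONVENTIONS §2); the duplicate is deliberate.
set_option linter.dupNamespace false

noncomputable section

open MeasureTheory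

namespace Summit.ABC.ABC.Theorems.ManyPrimeValuationProduct

/-- **The minimal lever suffices for the crux** (registered stub `manyPrimeValuationProduct_of_lever`
of line `jl-zero-cycle-height`; = the skeleton's `coveringGlue ∘ pairedFactorisationBound_of_meanSquare
∘ fermatInputOnClass`, abbreviations unfolded): Fermat input on the class → package → lever →
`ManyPrimeValuationProduct`. Per covering set: the package gives `(L, X, F, s)` with
`log T_D ≤ C₁ + (ε/2) log N + log V − log I`, the lever gives `log(V⁻¹ I) ≥ −((ε/2) log N + C₂)`, so
`T_D ≤ exp(C₁+C₂) N^ε`; then the covering glue. [folklore] -/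
theorem manyPrimeValuationProduct_of_lever :
    (∀ (W : WeierstrassCurve ℚ) [W.IsElliptic], (∀ p : ℕ, p.Prime → p ≠ 2 → ¬ p ^ 2 ∣
      W.conductorNorm ℤ) → 4 ≤ ((W.conductorNorm ℤ).primeFactors.filter (fun p => ¬ p ^ 2 ∣
      W.conductorNorm ℤ)).card → (∀ ℓ : ℕ, ℓ.Prime → 11 ≤ ℓ → ∃ r ∈ (W.conductorNorm
      ℤ).primeFactors.filter (fun p => ¬ p ^ 2 ∣ W.conductorNorm ℤ), ¬ ℓ ∣
      (W.minimalDiscriminantNorm ℤ).factorization r)) → (∀ ε : ℝ, 0 < ε → ∃ C : ℝ, ∀ (W :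
      WeierstrassCurve ℚ) [W.IsElliptic], (∀ p : ℕ, p.Prime → p ≠ 2 → ¬ p ^ 2 ∣ W.conductorNorm ℤ)
      → (∀ ℓ : ℕ, ℓ.Prime → 11 ≤ ℓ → ∃ r ∈ (W.conductorNorm ℤ).primeFactors.filter (fun p => ¬ p ^
      2 ∣ W.conductorNorm ℤ), ¬ ℓ ∣ (W.minimalDiscriminantNorm ℤ).factorization r) → ∀ D : Finset
      ℕ, (D ⊆ (W.conductorNorm ℤ).primeFactors.filter (fun p => ¬ p ^ 2 ∣ W.conductorNorm ℤ) ∧ Even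
      D.card ∧ 2 ≤ D.card ∧ 2 ≤ ((W.conductorNorm ℤ).primeFactors.filter (fun p => ¬ p ^ 2 ∣
      W.conductorNorm ℤ) \ D).card) → ∃ (L : PeriodPair) (X :
      Literature.NumberTheory.Automorphic.ShimuraCurveData (∏ p ∈ D, p) (W.conductorNorm ℤ / ∏ p ∈
      D, p)) (F : Set UpperHalfPlane) (s : CuspForm X.Gamma 2), (∃ C :
      WeierstrassCurve.VariableChange ℚ, (C • W).IsGloballyMinimal ∧
      Literature.NumberTheory.EllipticCurves.ModularForms.IsNeronLatticeOf ((C • W).baseChange ℂ)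
      L) ∧ Literature.NumberTheory.Automorphic.IsHypFundamentalDomain X.Gamma F ∧
      MeasureTheory.volume F ≠ 0 ∧ MeasureTheory.volume F ≠ ⊤ ∧ s ≠ 0 ∧
      Literature.NumberTheory.Automorphic.HasPeriodsIn X.Gamma s (L.lattice : Set ℂ) ∧
      MeasureTheory.IntegrableOn (fun z => ‖s z‖ ^ 2 * z.im ^ 2) F ∧ MeasureTheory.IntegrableOn
      (fun z => Real.log (‖s z‖ ^ 2 * z.im ^ 2)) F ∧ (∀ᵐ z ∂(MeasureTheory.volume.restrict F), 0 <
      ‖s z‖ ^ 2 * z.im ^ 2) ∧ (0 < ∫ z in F, ‖s z‖ ^ 2 * z.im ^ 2) ∧ Real.log ((∏ p ∈ D,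
      (W.minimalDiscriminantNorm ℤ).factorization p : ℕ) : ℝ) ≤ C + ε * Real.log (W.conductorNorm
      ℤ) + Real.log (MeasureTheory.volume F).toReal - Real.log (∫ z in F, ‖s z‖ ^ 2 * z.im ^ 2)) →
      (∀ ε : ℝ, 0 < ε → ∃ C : ℝ, ∀ (W : WeierstrassCurve ℚ) [W.IsElliptic], (∀ p : ℕ, p.Prime → p ≠
      2 → ¬ p ^ 2 ∣ W.conductorNorm ℤ) → ∀ D : Finset ℕ, (D ⊆ (W.conductorNorm
      ℤ).primeFactors.filter (fun p => ¬ p ^ 2 ∣ W.conductorNorm ℤ) ∧ Even D.card ∧ 2 ≤ D.card ∧ 2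
      ≤ ((W.conductorNorm ℤ).primeFactors.filter (fun p => ¬ p ^ 2 ∣ W.conductorNorm ℤ) \ D).card)
      → ∀ (L : PeriodPair), (∃ C : WeierstrassCurve.VariableChange ℚ, (C • W).IsGloballyMinimal ∧
      Literature.NumberTheory.EllipticCurves.ModularForms.IsNeronLatticeOf ((C • W).baseChange ℂ)
      L) → ∀ (X : Literature.NumberTheory.Automorphic.ShimuraCurveData (∏ p ∈ D, p)
      (W.conductorNorm ℤ / ∏ p ∈ D, p)) (F : Set UpperHalfPlane),
      Literature.NumberTheory.Automorphic.IsHypFundamentalDomain X.Gamma F → MeasureTheory.volume F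
      ≠ 0 → MeasureTheory.volume F ≠ ⊤ → ∀ (s : CuspForm X.Gamma 2), s ≠ 0 →
      Literature.NumberTheory.Automorphic.HasPeriodsIn X.Gamma s (L.lattice : Set ℂ) →
      MeasureTheory.IntegrableOn (fun z => Real.log (‖s z‖ ^ 2 * z.im ^ 2)) F →
      MeasureTheory.IntegrableOn (fun z => ‖s z‖ ^ 2 * z.im ^ 2) F → (∀ᵐ z
      ∂(MeasureTheory.volume.restrict F), 0 < ‖s z‖ ^ 2 * z.im ^ 2) → (0 < ∫ z in F, ‖s z‖ ^ 2 *
      z.im ^ 2) → -(ε * Real.log (W.conductorNorm ℤ) + C) ≤ Real.log ((MeasureTheory.volume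
      F).toReal⁻¹ * ∫ z in F, ‖s z‖ ^ 2 * z.im ^ 2)) →
      Summit.ABC.ABC.Theses.RibetTakahashiSplit.ManyPrimeValuationProduct := by
  intro hFI hJL hM
  refine manyPrimeValuationProduct_of_pairedFactorisationBound fun ε hε => ?_
  have hε2 : 0 < ε / 2 := half_pos hε
  obtain ⟨C₁, hC₁⟩ := hJL (ε / 2) hε2
  obtain ⟨C₂, hC₂⟩ := hM (ε / 2) hε2
  refine ⟨Real.exp (C₁ + C₂), fun W _ hss D hsub heven h2 h2' => ?_⟩
  have h4 : 4 ≤ ((W.conductorNorm ℤ).primeFactors.filter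
      (fun p => ¬ p ^ 2 ∣ W.conductorNorm ℤ)).card := by
    have h := Finset.card_sdiff_add_card_eq_card hsub
    omega
  have hF := hFI W hss h4
  obtain ⟨L, S, F, s, hL, hFD, hF0, hFt, hs0, hper, hint₁, hint₂, hpos, hIpos, hineq⟩ :=
    hC₁ W hss hF D ⟨hsub, heven, h2, h2'⟩
  have hm := hC₂ W hss D ⟨hsub, heven, h2, h2'⟩ L hL S F hFD hF0 hFt s hs0 hper hint₂ hint₁
    hpos hIpos
  set N : ℝ := (W.conductorNorm ℤ : ℝ) with hNdef
  set V : ℝ := (volume F).toReal with hVdef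
  set I : ℝ := ∫ z in F, ‖s z‖ ^ 2 * z.im ^ 2 with hIdef
  set T : ℕ := ∏ p ∈ D, (W.minimalDiscriminantNorm ℤ).factorization p with hTdef
  have hV : 0 < V := ENNReal.toReal_pos hF0 hFt
  have hlogVI : Real.log (V⁻¹ * I) = Real.log I - Real.log V := by
    rw [Real.log_mul (inv_ne_zero hV.ne') hIpos.ne', Real.log_inv]; ring
  rw [hlogVI] at hm
  have hlogT : Real.log (T : ℝ) ≤ C₁ + C₂ + ε * Real.log N := by linarith
  have hN0 : 0 < W.conductorNorm ℤ := W.conductorNorm_pos_holds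
  have hN : 0 < N := by rw [hNdef]; exact_mod_cast hN0
  have hT : (T : ℝ) ≤ Real.exp (Real.log (T : ℝ)) := by
    rcases Nat.eq_zero_or_pos T with h | h
    · rw [h]; simp
    · rw [Real.exp_log (by exact_mod_cast h)]
  calc (T : ℝ) ≤ Real.exp (Real.log (T : ℝ)) := hT
    _ ≤ Real.exp (C₁ + C₂ + ε * Real.log N) := Real.exp_le_exp.mpr hlogT
    _ = Real.exp (C₁ + C₂) * N ^ ε := by
        rw [Real.exp_add, Real.rpow_def_of_pos hN, mul_comm (Real.log N) ε]

/-- **The minimal lever is necessary modulo the lower half of the package** (registered stub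
`meanSquareLowerBound_of_lowerPackage_of_paired`; = the skeleton's `meanSquareLowerBound_of_paired`,
abbreviations unfolded): lower package → paired crux (`T_D ≤ C N^ε` on covering sets) → lever, by
`log(V⁻¹ I) = −(log V − log I) ≥ −log T_D − (ε/2) log N − C₁ ≥ −(|log C₂| + (ε/2) log N) − (ε/2) log N − C₁`
(`T_D ≥ 1`: every factor at a multiplicative prime is `≥ 1`). [folklore] -/
theorem meanSquareLowerBound_of_lowerPackage_of_paired :
    (∀ ε : ℝ, 0 < ε → ∃ C : ℝ, ∀ (W : WeierstrassCurve ℚ) [W.IsElliptic], (∀ p : ℕ, p.Prime → p ≠ 2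
      → ¬ p ^ 2 ∣ W.conductorNorm ℤ) → ∀ D : Finset ℕ, (D ⊆ (W.conductorNorm ℤ).primeFactors.filter
      (fun p => ¬ p ^ 2 ∣ W.conductorNorm ℤ) ∧ Even D.card ∧ 2 ≤ D.card ∧ 2 ≤ ((W.conductorNorm
      ℤ).primeFactors.filter (fun p => ¬ p ^ 2 ∣ W.conductorNorm ℤ) \ D).card) → ∀ (L :
      PeriodPair), (∃ C : WeierstrassCurve.VariableChange ℚ, (C • W).IsGloballyMinimal ∧
      Literature.NumberTheory.EllipticCurves.ModularForms.IsNeronLatticeOf ((C • W).baseChange ℂ)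
      L) → ∀ (X : Literature.NumberTheory.Automorphic.ShimuraCurveData (∏ p ∈ D, p)
      (W.conductorNorm ℤ / ∏ p ∈ D, p)) (F : Set UpperHalfPlane),
      Literature.NumberTheory.Automorphic.IsHypFundamentalDomain X.Gamma F → MeasureTheory.volume F
      ≠ 0 → MeasureTheory.volume F ≠ ⊤ → ∀ (s : CuspForm X.Gamma 2), s ≠ 0 →
      Literature.NumberTheory.Automorphic.HasPeriodsIn X.Gamma s (L.lattice : Set ℂ) → (0 < ∫ z in
      F, ‖s z‖ ^ 2 * z.im ^ 2) → Real.log (MeasureTheory.volume F).toReal - Real.log (∫ z in F, ‖s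
      z‖ ^ 2 * z.im ^ 2) - ε * Real.log (W.conductorNorm ℤ) - C ≤ Real.log ((∏ p ∈ D,
      (W.minimalDiscriminantNorm ℤ).factorization p : ℕ) : ℝ)) → (∀ ε : ℝ, 0 < ε → ∃ C : ℝ, ∀ (W :
      WeierstrassCurve ℚ) [W.IsElliptic], (∀ p : ℕ, p.Prime → p ≠ 2 → ¬ p ^ 2 ∣ W.conductorNorm ℤ)
      → ∀ D : Finset ℕ, (D ⊆ (W.conductorNorm ℤ).primeFactors.filter (fun p => ¬ p ^ 2 ∣
      W.conductorNorm ℤ) ∧ Even D.card ∧ 2 ≤ D.card ∧ 2 ≤ ((W.conductorNorm ℤ).primeFactors.filter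
      (fun p => ¬ p ^ 2 ∣ W.conductorNorm ℤ) \ D).card) → ((∏ p ∈ D, (W.minimalDiscriminantNorm
      ℤ).factorization p : ℕ) : ℝ) ≤ C * (W.conductorNorm ℤ : ℝ) ^ ε) → (∀ ε : ℝ, 0 < ε → ∃ C : ℝ,
      ∀ (W : WeierstrassCurve ℚ) [W.IsElliptic], (∀ p : ℕ, p.Prime → p ≠ 2 → ¬ p ^ 2 ∣
      W.conductorNorm ℤ) → ∀ D : Finset ℕ, (D ⊆ (W.conductorNorm ℤ).primeFactors.filter (fun p => ¬
      p ^ 2 ∣ W.conductorNorm ℤ) ∧ Even D.card ∧ 2 ≤ D.card ∧ 2 ≤ ((W.conductorNorm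
      ℤ).primeFactors.filter (fun p => ¬ p ^ 2 ∣ W.conductorNorm ℤ) \ D).card) → ∀ (L :
      PeriodPair), (∃ C : WeierstrassCurve.VariableChange ℚ, (C • W).IsGloballyMinimal ∧
      Literature.NumberTheory.EllipticCurves.ModularForms.IsNeronLatticeOf ((C • W).baseChange ℂ)
      L) → ∀ (X : Literature.NumberTheory.Automorphic.ShimuraCurveData (∏ p ∈ D, p)
      (W.conductorNorm ℤ / ∏ p ∈ D, p)) (F : Set UpperHalfPlane),
      Literature.NumberTheory.Automorphic.IsHypFundamentalDomain X.Gamma F → MeasureTheory.volume F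
      ≠ 0 → MeasureTheory.volume F ≠ ⊤ → ∀ (s : CuspForm X.Gamma 2), s ≠ 0 →
      Literature.NumberTheory.Automorphic.HasPeriodsIn X.Gamma s (L.lattice : Set ℂ) →
      MeasureTheory.IntegrableOn (fun z => Real.log (‖s z‖ ^ 2 * z.im ^ 2)) F →
      MeasureTheory.IntegrableOn (fun z => ‖s z‖ ^ 2 * z.im ^ 2) F → (∀ᵐ z
      ∂(MeasureTheory.volume.restrict F), 0 < ‖s z‖ ^ 2 * z.im ^ 2) → (0 < ∫ z in F, ‖s z‖ ^ 2 *
      z.im ^ 2) → -(ε * Real.log (W.conductorNorm ℤ) + C) ≤ Real.log ((MeasureTheory.volume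
      F).toReal⁻¹ * ∫ z in F, ‖s z‖ ^ 2 * z.im ^ 2)) := by
  intro hlow hP ε hε
  have hε2 : 0 < ε / 2 := half_pos hε
  obtain ⟨C₁, hC₁⟩ := hlow (ε / 2) hε2
  obtain ⟨C₂, hC₂⟩ := hP (ε / 2) hε2
  refine ⟨C₁ + |Real.log C₂|, fun W _ hss D hD L hL S F hFD hF0 hFt s hs0 hper _ _ _ hI => ?_⟩
  set N : ℝ := (W.conductorNorm ℤ : ℝ) with hNdef
  set V : ℝ := (volume F).toReal with hVdef
  set I : ℝ := ∫ z in F, ‖s z‖ ^ 2 * z.im ^ 2 with hIdef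
  set T : ℕ := ∏ p ∈ D, (W.minimalDiscriminantNorm ℤ).factorization p with hTdef
  have hV : 0 < V := ENNReal.toReal_pos hF0 hFt
  have h1 := hC₁ W hss D hD L hL S F hFD hF0 hFt s hs0 hper hI
  have h2 := hC₂ W hss D hD
  have hN0 : 0 < W.conductorNorm ℤ := W.conductorNorm_pos_holds
  have hN : 0 < N := by rw [hNdef]; exact_mod_cast hN0
  have hT1 : (1 : ℝ) ≤ T := by
    have : 1 ≤ T :=
      Finset.one_le_prod' fun p hp => one_le_factorization_of_mem_filter W (hD.1 hp)
    exact_mod_cast this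
  have hC₂pos : 0 < C₂ := by
    by_contra hle
    push Not at hle
    have : C₂ * N ^ (ε / 2) ≤ 0 := mul_nonpos_of_nonpos_of_nonneg hle (Real.rpow_nonneg hN.le _)
    linarith
  have hlogT : Real.log (T : ℝ) ≤ |Real.log C₂| + ε / 2 * Real.log N := by
    have hTpos : (0 : ℝ) < T := lt_of_lt_of_le one_pos hT1
    calc Real.log (T : ℝ) ≤ Real.log (C₂ * N ^ (ε / 2)) := Real.log_le_log hTpos h2
      _ = Real.log C₂ + ε / 2 * Real.log N := by
          rw [Real.log_mul hC₂pos.ne' (Real.rpow_pos_of_pos hN _).ne', Real.log_rpow hN]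
      _ ≤ |Real.log C₂| + ε / 2 * Real.log N := by linarith [le_abs_self (Real.log C₂)]
  have hlogVI : Real.log (V⁻¹ * I) = Real.log I - Real.log V := by
    rw [Real.log_mul (inv_ne_zero hV.ne') hI.ne', Real.log_inv]; ring
  rw [hlogVI]
  linarith

end Summit.ABC.ABC.Theorems.ManyPrimeValuationProduct

end
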